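import Summits.Schanuel.Schanuel.Theorems.DiophantineDichotomyApproximationPropertyCycleAPIOne
import Literature.NumberTheory.Transcendental.NesterenkoUResultantHeight
import Literature.NumberTheory.Transcendental.SixExponentialsSeveralVariablesAuxiliary
import Mathlib.Analysis.SpecialFunctions.Pow.Real
import HarnessLib

/-!
# Stub A `stub_ternaryBox` of line `orbit-interpolation-determinant` (crux `ApproximationProperty`, stmt-Schanuel-6117)

Route `DiophantineDichotomy` (sub-problem `Schanuel/Schanuel`), crux
`Summit.Schanuel.Schanuel.Theses.DiophantineDichotomy.ApproximationProperty`, line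
`orbit-interpolation-determinant`, registered stub `stub_ternaryBox` (stub A): **Dirichlet's box
principle for ternary forms** at the point `(1, ω₁, ω₂)`, in Nesterenko's elimination language
(`Rx 2 = ℚ[x₀, x₁, x₂]`, `maxNorm` = `|P|`, `height` = `h(P)` of
`Literature.NumberTheory.Transcendental.Nesterenko`).

For `ω ∈ ℂ²` put `B = ‖(1, ω)‖ ≥ 1` (sup norm) and `c = 4 + log B`. For integers `D ≥ 2`, `N ≥ 1`
let `M = (D + 1)(D + 2)/2` be the number of monomials `x^e` of degree `D` in three variables and
`E = ⌊(M − 1)/2⌋`, so that `2E < M` and `E − 1 ≥ D²/8`. The values `(1, ω)^e` have modulus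
`≤ B^D`; the tree's box principle for one complex linear form
(`Waldschmidt1981.box_principle_complex`, `k = (N+1)^E`, `k² < (N+1)^M`) gives integers `p_e`, not
all zero, `|p_e| ≤ N`, with `|∑ p_e (1, ω)^e| ≤ 2(2 M B^D N + 1)/k ≤ 4 M B^D (N+1)^{1−E}`, and
`4M ≤ e^{2D+2}`, whence `|P(1, ω)| ≤ exp(c D − (D²/8) log(N+1))` for the form `P = ∑ p_e x^e`:
non-zero, homogeneous of degree `D`, integer coefficients of modulus `≤ N` (`1 ≤ |P| ≤ N`), and
`h(P) ≤ log |P| ≤ log N` (`height_map_le_log_maxNorm`, `CycleAPIOne.maxNorm_le_of_forall_le` of the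
landed `t = 1` stub).

Proofs only: no definitions, no named facts; the registered statement and private lemmas
(sub-namespace `TernaryBox`). Sources: the box principle (Dirichlet, Thue–Siegel; M. Waldschmidt,
Invent. Math. 63 (1981) §3); Yu. V. Nesterenko, LNM 1752 (2001) Ch. 3 §4 (Def. 4.1, 4.2).
-/

set_option linter.dupNamespace false

noncomputable section

namespace Summit.Schanuel.Schanuel.Cruxes.ApproximationProperty.OrbitInterpolationDeterminant

open Literature.NumberTheory.Transcendental.Nesterenko MvPolynomial Module
open scoped BigOperators

namespace TernaryBox

/-! ## Coefficients -/

/-- The coefficients of `∑_e p_e x^e`, the sum over the exponents `e` of degree `D`: `p_e` in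
degree `D`, zero elsewhere. [folklore] -/
theorem coeff_sum_monomial {σ : Type*} {D : ℕ} [Fintype {m : σ →₀ ℕ // m.degree = D}]
    (p : {m : σ →₀ ℕ // m.degree = D} → ℤ) (m : σ →₀ ℕ) :
    coeff m (∑ e : {m : σ →₀ ℕ // m.degree = D}, monomial e.1 (p e) : MvPolynomial σ ℤ) =
      if h : m.degree = D then p ⟨m, h⟩ else 0 := by
  classical
  rw [coeff_sum]
  simp_rw [coeff_monomial]
  split_ifs with h
  · rw [Finset.sum_eq_single (⟨m, h⟩ : {m : σ →₀ ℕ // m.degree = D})]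
    · exact if_pos rfl
    · rintro e - hne
      exact if_neg fun heq => hne (Subtype.ext heq)
    · exact fun hm => absurd (Finset.mem_univ _) hm
  · refine Finset.sum_eq_zero fun e _ => ?_
    exact if_neg fun heq : (e : σ →₀ ℕ) = m => h (heq ▸ e.2)

/-- `(∑_e p_e x^e)(ξ) = ∑_e p_e ξ^e` for integer coefficients read in `ℚ` and a complex point.
[folklore] -/
theorem aeval_map_sum_monomial {σ ι : Type*} (s : Finset ι) (d : ι → σ →₀ ℕ) (p : ι → ℤ)
    (x : σ → ℂ) :
    aeval x (MvPolynomial.map (Int.castRingHom ℚ) (∑ i ∈ s, monomial (d i) (p i))) =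
      ∑ i ∈ s, (p i : ℂ) * (d i).prod fun j k => x j ^ k := by
  rw [← algebraMap_int_eq, aeval_map_algebraMap, map_sum]
  refine Finset.sum_congr rfl fun i _ => ?_
  rw [aeval_monomial, algebraMap_int_eq, eq_intCast]

/-- `|ξ^e| ≤ ‖ξ‖^{|e|}` for the sup norm. [folklore] -/
theorem norm_prod_pow_le {n : ℕ} (x : Fin n → ℂ) (d : Fin n →₀ ℕ) :
    ‖d.prod fun j k => x j ^ k‖ ≤ ‖x‖ ^ d.degree := by
  rw [Finsupp.prod_pow, norm_prod, Finsupp.degree_eq_sum, ← Finset.prod_pow_eq_pow_sum]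
  refine Finset.prod_le_prod (fun j _ => norm_nonneg _) fun j _ => ?_
  rw [norm_pow]
  exact pow_le_pow_left₀ (norm_nonneg _) (norm_le_pi_norm x j) _

/-! ## Counting the monomials of degree `D` in three variables -/

/-- `2 · binom(D + 2, 2) = (D + 2)(D + 1)`. [folklore] -/
theorem choose_two_mul_two (D : ℕ) : (D + 2).choose 2 * 2 = (D + 2) * (D + 1) := by
  have h := Nat.add_one_mul_choose_eq (D + 1) 1
  rw [Nat.choose_one_right] at h
  exact h.symm

/-- There are `M = (D + 2)(D + 1)/2` monomials of degree `D` in `x₀, x₁, x₂` (stars and bars,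
the tree's `card_monomialsOfDegree`). [folklore] -/
theorem card_monomials (D : ℕ) [Fintype {m : Fin (2 + 1) →₀ ℕ // m.degree = D}] :
    Fintype.card {m : Fin (2 + 1) →₀ ℕ // m.degree = D} * 2 = (D + 2) * (D + 1) := by
  have h : Nat.card {m : Fin (2 + 1) →₀ ℕ // m.degree = D} = (2 + 1 + D - 1).choose D :=
    Literature.RingTheory.HilbertSamuel.card_monomialsOfDegree (2 + 1) D
  rw [Nat.card_eq_fintype_card, show 2 + 1 + D - 1 = D + 2 by omega, Nat.choose_symm_add] at h
  rw [h]
  exact choose_two_mul_two D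

/-! ## The final arithmetic -/

/-- `4M ≤ e^{2D + 2}` for `2M = (D + 2)(D + 1)`. [folklore] -/
theorem four_mul_card_le_exp {M D : ℕ} (hM : (M : ℝ) * 2 = ((D : ℝ) + 2) * (D + 1)) :
    4 * (M : ℝ) ≤ Real.exp (2 * D + 2) := by
  have h1 : (D : ℝ) + 1 ≤ Real.exp D := Real.add_one_le_exp _
  have h2 : (D : ℝ) + 2 ≤ Real.exp (D + 1) := by
    have := Real.add_one_le_exp ((D : ℝ) + 1)
    linarith
  have h3 : (2 : ℝ) ≤ Real.exp 1 := by
    have := Real.add_one_le_exp (1 : ℝ)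
    linarith
  calc 4 * (M : ℝ) = 2 * (((D : ℝ) + 2) * (D + 1)) := by linarith [hM]
    _ ≤ Real.exp 1 * (Real.exp (D + 1) * Real.exp D) := by gcongr
    _ = Real.exp (2 * D + 2) := by
        rw [← Real.exp_add, ← Real.exp_add]
        congr 1
        ring

/-- The bookkeeping: `2(2 M B^D N + 1)/(N+1)^E ≤ exp((4 + log B) D − (D²/8) log(N+1))` when
`B ≥ 1`, `D ≥ 2`, `M ≥ 1`, `2M = (D+2)(D+1)` and `E − 1 ≥ D²/8`. [folklore] -/
theorem final_bound {M E D N : ℕ} {B : ℝ} (hB : 1 ≤ B) (hD : 2 ≤ D) (hM1 : 1 ≤ M)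
    (hM : (M : ℝ) * 2 = ((D : ℝ) + 2) * (D + 1)) (hE : (D : ℝ) ^ 2 / 8 ≤ (E : ℝ) - 1) :
    2 * ((2 * (M : ℝ) * B ^ D * N + 1) / (((N + 1) ^ E : ℕ) : ℝ)) ≤
      Real.exp ((4 + Real.log B) * D - (D : ℝ) ^ 2 / 8 * Real.log ((N : ℝ) + 1)) := by
  have hB0 : 0 < B := one_pos.trans_le hB
  set L : ℝ := Real.log ((N : ℝ) + 1)
  have hN0 : (0 : ℝ) ≤ N := Nat.cast_nonneg N
  have hN1 : (0 : ℝ) < (N : ℝ) + 1 := by positivity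
  have hL0 : 0 ≤ L := Real.log_nonneg (by linarith)
  have hNL : ((N : ℝ) + 1) = Real.exp L := (Real.exp_log hN1).symm
  have hk : (((N + 1) ^ E : ℕ) : ℝ) = Real.exp (E * L) := by
    push_cast
    rw [hNL, ← Real.exp_nat_mul]
  have hA : B ^ D = Real.exp (D * Real.log B) := by
    rw [Real.exp_nat_mul, Real.exp_log hB0]
  have h4M : 4 * (M : ℝ) ≤ Real.exp (2 * D + 2) := four_mul_card_le_exp hM
  have hM0 : (1 : ℝ) ≤ M := by exact_mod_cast hM1
  have hA1 : 1 ≤ B ^ D := one_le_pow₀ hB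
  have hMA : (1 : ℝ) * 1 ≤ M * B ^ D := mul_le_mul hM0 hA1 zero_le_one (by positivity)
  have hkpos : (0 : ℝ) < (((N + 1) ^ E : ℕ) : ℝ) := by positivity
  have hD' : (2 : ℝ) ≤ D := by exact_mod_cast hD
  calc 2 * ((2 * (M : ℝ) * B ^ D * N + 1) / (((N + 1) ^ E : ℕ) : ℝ))
      = (4 * M * B ^ D * N + 2) / (((N + 1) ^ E : ℕ) : ℝ) := by ring
    _ ≤ 4 * M * B ^ D * ((N : ℝ) + 1) / (((N + 1) ^ E : ℕ) : ℝ) := by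
        refine div_le_div_of_nonneg_right ?_ hkpos.le
        nlinarith
    _ ≤ Real.exp (2 * D + 2) * Real.exp (D * Real.log B) * Real.exp L / Real.exp (E * L) := by
        rw [← hA, ← hk, ← hNL]
        gcongr
    _ = Real.exp (2 * D + 2 + D * Real.log B + L - E * L) := by
        rw [← Real.exp_add, ← Real.exp_add, ← Real.exp_sub]
    _ ≤ Real.exp ((4 + Real.log B) * D - (D : ℝ) ^ 2 / 8 * L) := by
        rw [Real.exp_le_exp]
        have hEL : 0 ≤ ((E : ℝ) - 1 - (D : ℝ) ^ 2 / 8) * L := mul_nonneg (by linarith) hL0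
        nlinarith

end TernaryBox

/-! ## The stub -/

/-- **Stub A — Dirichlet's box principle for ternary forms.** For `ω ∈ ℂ²` there is
`c = c(ω) > 0` (here `c = 4 + log ‖(1, ω)‖`) such that for all integers `D ≥ 2`, `N ≥ 1` some
non-zero form `P ∈ ℚ[x₀, x₁, x₂]` of degree `D` with integer coefficients of modulus `≤ N` (so
`1 ≤ |P| ≤ N` and `h(P) ≤ log N`) satisfies `|P(1, ω)| ≤ exp(c D − (D²/8) log(N + 1))`: the
pigeonhole on the `(D+1)(D+2)/2` monomials of degree `D` evaluated at `(1, ω)`. [folklore] -/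
theorem stub_ternaryBox :
    ∀ ω : Fin 2 → ℂ, ∃ c : ℝ, 0 < c ∧ ∀ D N : ℕ, 2 ≤ D → 1 ≤ N →
      ∃ P : Rx 2, P ≠ 0 ∧ P.IsHomogeneous D ∧ 1 ≤ maxNorm P ∧ maxNorm P ≤ N ∧
        height P ≤ Real.log N ∧
        ‖aeval (Fin.cons 1 ω : Fin (2 + 1) → ℂ) P‖ ≤
          Real.exp (c * D - (D : ℝ) ^ 2 / 8 * Real.log ((N : ℝ) + 1)) := by
  intro ω
  classical
  set x : Fin (2 + 1) → ℂ := Fin.cons 1 ω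
  -- the constant: `B = ‖(1, ω)‖ ≥ 1`, `c = 4 + log B`
  set B : ℝ := ‖x‖
  have hB1 : 1 ≤ B :=
    calc (1 : ℝ) = ‖x 0‖ := by rw [show x 0 = 1 from rfl, norm_one]
      _ ≤ B := norm_le_pi_norm x 0
  have hlogB : 0 ≤ Real.log B := Real.log_nonneg hB1
  refine ⟨4 + Real.log B, by linarith, fun D N hD _hN => ?_⟩
  -- the `M = (D+1)(D+2)/2` monomials of degree `D`, `E = ⌊(M-1)/2⌋`
  haveI : Fintype {m : Fin (2 + 1) →₀ ℕ // m.degree = D} := Fintype.ofFinite _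
  set M : ℕ := Fintype.card {m : Fin (2 + 1) →₀ ℕ // m.degree = D} with hMdef
  have hM2 : M * 2 = (D + 2) * (D + 1) := TernaryBox.card_monomials D
  have hM6 : 6 ≤ M := by
    have : 4 * 3 ≤ (D + 2) * (D + 1) := Nat.mul_le_mul (by omega) (by omega)
    omega
  set E : ℕ := (M - 1) / 2 with hEdef
  have hEM : E * 2 < M := by omega
  have hE1 : (D : ℝ) ^ 2 / 8 ≤ (E : ℝ) - 1 := by
    have h1 : M ≤ 2 * E + 2 := by omega
    have h1' : (M : ℝ) ≤ 2 * E + 2 := by exact_mod_cast h1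
    have h2' : (M : ℝ) * 2 = ((D : ℝ) + 2) * (D + 1) := by exact_mod_cast hM2
    have hD' : (2 : ℝ) ≤ D := by exact_mod_cast hD
    nlinarith [mul_nonneg (sub_nonneg.2 hD') (sub_nonneg.2 hD')]
  -- the values of the monomials at `(1, ω)` and the box principle
  set a : Fin 1 → {m : Fin (2 + 1) →₀ ℕ // m.degree = D} → ℂ :=
    fun _ e => e.1.prod fun j k => x j ^ k
  have hA0 : (0 : ℝ) ≤ B ^ D := by positivity
  have hA : ∀ i e, ‖a i e‖ ≤ B ^ D := fun i e => by
    have h := TernaryBox.norm_prod_pow_le x e.1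
    rw [e.2] at h
    exact h
  have hk : 0 < (N + 1) ^ E := by positivity
  have hcard : ((N + 1) ^ E) ^ (2 * Fintype.card (Fin 1)) <
      (N + 1) ^ Fintype.card {m : Fin (2 + 1) →₀ ℕ // m.degree = D} := by
    rw [Fintype.card_fin, mul_one, ← pow_mul, ← hMdef]
    exact Nat.pow_lt_pow_right (by omega) hEM
  obtain ⟨p, hp0, hpN, hpval⟩ :=
    Literature.NumberTheory.Transcendental.Waldschmidt1981.box_principle_complex a hA0 hA N
      ((N + 1) ^ E) hk hcard
  have hval := hpval 0
  -- the form `P = ∑_e p_e x^e`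
  set Z : MvPolynomial (Fin (2 + 1)) ℤ :=
    ∑ e : {m : Fin (2 + 1) →₀ ℕ // m.degree = D}, monomial e.1 (p e) with hZ
  have hcoeff : ∀ m : Fin (2 + 1) →₀ ℕ,
      coeff m Z = if h : m.degree = D then p ⟨m, h⟩ else 0 :=
    TernaryBox.coeff_sum_monomial p
  have hZ0 : Z ≠ 0 := by
    intro h
    apply hp0
    funext e
    have h1 := hcoeff e.1
    rw [h, coeff_zero, dif_pos e.2] at h1
    exact h1.symm
  have hZhom : Z.IsHomogeneous D := by
    rw [hZ]
    exact IsHomogeneous.sum _ _ _ fun e _ => isHomogeneous_monomial _ e.2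
  have hinj : Function.Injective (MvPolynomial.map (σ := Fin (2 + 1)) (Int.castRingHom ℚ)) :=
    map_injective _ (RingHom.injective_int _)
  have hP0 : MvPolynomial.map (Int.castRingHom ℚ) Z ≠ 0 := (map_ne_zero_iff _ hinj).mpr hZ0
  -- `1 ≤ |P| ≤ N`, `h(P) ≤ log N`
  have hP1 : 1 ≤ maxNorm (MvPolynomial.map (Int.castRingHom ℚ) Z) := by
    obtain ⟨γ, hγ⟩ := MvPolynomial.ne_zero_iff.mp hP0
    refine le_trans ?_ (norm_coeff_le_maxNorm _ γ)
    rw [coeff_map, eq_intCast] at hγ ⊢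
    have hz : coeff γ Z ≠ 0 := fun h => hγ (by rw [h, Int.cast_zero])
    rw [Int.norm_cast_rat, Int.norm_eq_abs]
    exact_mod_cast Int.one_le_abs hz
  have hPN : maxNorm (MvPolynomial.map (Int.castRingHom ℚ) Z) ≤ N := by
    refine CycleAPIOne.maxNorm_le_of_forall_le _ (by positivity) fun γ => ?_
    rw [coeff_map, eq_intCast, Int.norm_cast_rat, Int.norm_eq_abs, hcoeff γ]
    split_ifs with h
    · exact_mod_cast hpN _
    · simp
  have hPh : height (MvPolynomial.map (Int.castRingHom ℚ) Z) ≤ Real.log N :=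
    (height_map_le_log_maxNorm Z hZ0).trans (Real.log_le_log (by linarith) hPN)
  -- the value at `(1, ω)`
  have hPval : aeval x (MvPolynomial.map (Int.castRingHom ℚ) Z) = ∑ e, (p e : ℂ) * a 0 e := by
    rw [hZ]
    exact TernaryBox.aeval_map_sum_monomial _ _ _ x
  refine ⟨MvPolynomial.map (Int.castRingHom ℚ) Z, hP0, hZhom.map _, hP1, hPN, hPh, ?_⟩
  rw [hPval]
  have hM1 : 1 ≤ M := by omega
  have hM2' : (M : ℝ) * 2 = ((D : ℝ) + 2) * (D + 1) := by exact_mod_cast hM2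
  exact hval.trans (TernaryBox.final_bound hB1 hD hM1 hM2' hE1)

end Summit.Schanuel.Schanuel.Cruxes.ApproximationProperty.OrbitInterpolationDeterminant

end
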